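import Summits.AtomisticToContinuum.HydrodynamicLimit.Theorems.JParityClosureParityBandClosureEnergyFloorPointwise
import Summits.AtomisticToContinuum.HydrodynamicLimit.Theorems.LocalSecondLaw.Negative.Functional
import HarnessLib

/-!
# Line `entropy-floor-fixes-energy` (crux `JParityClosure.ParityBandClosure`, stmt-AtomisticToContinuum-17608),
# stub `stub_energyFloorOfEntropyFloor` — part 2: the squeeze INTEGRATED over `𝕋³` for one configuration

For one configuration `w` of `n ≥ 1` particles, one scale `r`, a weight `ψ ≥ 0` and a reference state
`(ρ̃ > 0, ũ, θ̃ > 0)` (continuous on `𝕋³`), the pointwise inequality `pointwise_energy_floor` of part 1 is integrated over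
the centre `x ∈ 𝕋³`:

`∫ψẼ + ∫ψθ̃(Hs(ρ̃,θ̃) − Hs(ρ_r,θ_r)) − K₀∫|ρ_r − ρ̃| + ∫ψ⟪ũ, m_r − ρ̃ũ⟫ ≤ ∫ψ e_r`

(`integrated_energy_floor`), under: the band data of `f_ex` (continuity, a sup bound and a Lipschitz bound on
`[0, ηb] ∋ ρ_rσ³, ρ̃σ³`), the cold-cell side condition at every centre, a uniform bound `K₀` of the pointwise constant,
and INTEGRABILITY of the coarse-grained entropy `x ↦ Hs(ρ_r(x), θ_r(x))` (the registered stub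
`stub_coarseEntropyIntegrable` supplies it on the capped, coincidence-free event) — every other integrand is continuous.
`Hs` is `LocalSecondLawNegative.Hs` (DEFINITIONALLY the crux's `let Hs`). Also here: continuity of the reference entropy
`x ↦ Hs(ρ̃(x), θ̃(x))` (`continuous_Hs_ref`) and the component form of the momentum term
(`integral_inner_eq_sum`, for the comparison with the `χ`-tested momentum conjunct in part 3).
No probability, no dynamics, no named fact.
-/

noncomputable section

namespace Summit.AtomisticToContinuum.HydrodynamicLimit.Theorems.ParityBandClosureEnergyFloor

open MeasureTheory Filter Set Topology
open scoped ENNReal InnerProductSpace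
open Literature.MathematicalPhysics.KineticTheory Literature.Analysis.FluidPDE
open Literature.Analysis.FunctionSpaces
open Summit.AtomisticToContinuum.HydrodynamicLimit.Theorems.DensityCapNegative
  (cone cone_nonneg cone_le mollDensity mollDensity_eq mollDensity_nonneg)
open Summit.AtomisticToContinuum.HydrodynamicLimit.Theorems.KineticClosureDensity (continuous_mollDensity)
open Summit.AtomisticToContinuum.HydrodynamicLimit.Theorems.KineticClosureBridge
  (continuous_mollMomentum continuous_mollEnergy norm_empiricalMomentumField_sub_integral_smul_le)
open Summit.AtomisticToContinuum.HydrodynamicLimit.Theorems.LocalSecondLawNegative (Hs)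

/-! ## §1 Continuity of the reference entropy and integrability bookkeeping -/

/-- On `{a > 0, b > 0}` the guarded entropy is the formula. [folklore] -/
theorem Hs_of_pos (σ : ℝ) {a b : ℝ} (ha : 0 < a) (hb : 0 < b) :
    Hs σ a b = -(a * (3 / 2 * Real.log b - Real.log a - hsExcessFreeEnergy (a * σ ^ 3))) := by
  simp only [Hs, if_pos (And.intro ha hb)]

/-- **Continuity of the reference entropy** `x ↦ Hs(ρ̃(x), θ̃(x))` for continuous positive `ρ̃, θ̃` with `ρ̃σ³` in a
band where `f_ex` is continuous. [folklore] -/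
theorem continuous_Hs_ref (σ : ℝ) {ηb : ℝ} (hf : ContinuousOn hsExcessFreeEnergy (Set.Icc 0 ηb))
    {ρt θt : T3 → ℝ} (hρtc : Continuous ρt) (hθtc : Continuous θt) (hρt : ∀ x, 0 < ρt x) (hθt : ∀ x, 0 < θt x)
    (hσ : 0 ≤ σ) (hρtb : ∀ x, ρt x * σ ^ 3 ≤ ηb) :
    Continuous fun x => Hs σ (ρt x) (θt x) := by
  have heq : (fun x => Hs σ (ρt x) (θt x)) =
      fun x => -(ρt x * (3 / 2 * Real.log (θt x) - Real.log (ρt x) - hsExcessFreeEnergy (ρt x * σ ^ 3))) :=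
    funext fun x => Hs_of_pos σ (hρt x) (hθt x)
  rw [heq]
  have hlogθ : Continuous fun x => Real.log (θt x) := hθtc.log fun x => (hθt x).ne'
  have hlogρ : Continuous fun x => Real.log (ρt x) := hρtc.log fun x => (hρt x).ne'
  have hfex : Continuous fun x => hsExcessFreeEnergy (ρt x * σ ^ 3) := by
    refine hf.comp_continuous (hρtc.mul continuous_const) fun x => ?_
    exact ⟨mul_nonneg (hρt x).le (pow_nonneg hσ 3), hρtb x⟩
  exact (hρtc.mul ((continuous_const.mul hlogθ).sub hlogρ |>.sub hfex)).neg

/-- The reference total energy density is continuous. [folklore] -/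
theorem continuous_totalEnergy_ref {ρt θt : T3 → ℝ} {ut : T3 → V3} (hρtc : Continuous ρt) (hθtc : Continuous θt)
    (hutc : Continuous ut) : Continuous fun x => totalEnergyDensity (ρt x) (ut x) (θt x) := by
  unfold totalEnergyDensity
  exact hρtc.mul (((hutc.norm.pow 2).div_const 2).add (continuous_const.mul hθtc))

/-! ## §2 The integrated squeeze -/

/-- **The squeeze integrated over `𝕋³`** (one configuration `w` of `n ≥ 1` particles, scale `r > 0`; notation of the
module docstring; `ρ_r = mollDensity`, `m_r`, `e_r` the cone-mollified fields, `θ_r` the cell temperature):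
`∫ψẼ + ∫ψθ̃(Hs(ρ̃,θ̃) − Hs(ρ_r,θ_r)) − K₀∫|ρ_r − ρ̃| + ∫ψ⟪ũ, m_r − ρ̃ũ⟫ ≤ ∫ψe_r`. [folklore] -/
theorem integrated_energy_floor {n : ℕ} (hn : n ≠ 0) {σ r ηb B L K₀ : ℝ} (hσ : 0 ≤ σ) (hr : 0 < r)
    (w : Config n (Fin 3) T3) {ψ ρt θt : T3 → ℝ} {ut : T3 → V3}
    (hψc : Continuous ψ) (hρtc : Continuous ρt) (hθtc : Continuous θt) (hutc : Continuous ut)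
    (hψ : ∀ x, 0 ≤ ψ x) (hρt : ∀ x, 0 < ρt x) (hθt : ∀ x, 0 < θt x)
    (hf : ContinuousOn hsExcessFreeEnergy (Set.Icc 0 ηb))
    (hB : ∀ a ∈ Set.Icc (0 : ℝ) ηb, |hsExcessFreeEnergy a| ≤ B)
    (hL : ∀ a ∈ Set.Icc (0 : ℝ) ηb, ∀ b ∈ Set.Icc (0 : ℝ) ηb, |hsExcessFreeEnergy a - hsExcessFreeEnergy b| ≤ L * |a - b|)
    (hρb : ∀ x, mollDensity r w x * σ ^ 3 ≤ ηb) (hρtb : ∀ x, ρt x * σ ^ 3 ≤ ηb)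
    (hJ : ∀ x, 2 / 3 * (empiricalEnergyField w (fun y => cone r y x) / mollDensity r w x -
        ‖empiricalMomentumField w (fun y => cone r y x)‖ ^ 2 / (2 * mollDensity r w x ^ 2)) ≤ 0 →
      0 < mollDensity r w x →
      3 / 2 * mollDensity r w x ≤ mollDensity r w x *
        (3 / 2 * Real.log (θt x) - Real.log (mollDensity r w x) - hsExcessFreeEnergy (mollDensity r w x * σ ^ 3)))
    (hint : Integrable (fun x : T3 => Hs σ (mollDensity r w x)
      (2 / 3 * (empiricalEnergyField w (fun y => cone r y x) / mollDensity r w x -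
        ‖empiricalMomentumField w (fun y => cone r y x)‖ ^ 2 / (2 * mollDensity r w x ^ 2)))))
    (hK : ∀ x, ψ x * (θt x * (3 / 2 * |Real.log (θt x)| + |Real.log (ρt x)| + 1 + B + ρt x * σ ^ 3 * L) +
      3 / 2 * θt x + ‖ut x‖ ^ 2 / 2) ≤ K₀) :
    (∫ x, ψ x * totalEnergyDensity (ρt x) (ut x) (θt x)) +
      (∫ x, ψ x * θt x * (Hs σ (ρt x) (θt x) - Hs σ (mollDensity r w x)
        (2 / 3 * (empiricalEnergyField w (fun y => cone r y x) / mollDensity r w x -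
          ‖empiricalMomentumField w (fun y => cone r y x)‖ ^ 2 / (2 * mollDensity r w x ^ 2))))) -
      K₀ * (∫ x, |mollDensity r w x - ρt x|) +
      (∫ x, ψ x * ⟪ut x, empiricalMomentumField w (fun y => cone r y x) - ρt x • ut x⟫_ℝ) ≤
    ∫ x, ψ x * empiricalEnergyField w (fun y => cone r y x) := by
  -- abbreviations
  set ρ : T3 → ℝ := fun x => mollDensity r w x with hρdef
  set M : T3 → V3 := fun x => empiricalMomentumField w (fun y => cone r y x) with hMdef
  set E : T3 → ℝ := fun x => empiricalEnergyField w (fun y => cone r y x) with hEdef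
  set θ : T3 → ℝ := fun x => 2 / 3 * (E x / ρ x - ‖M x‖ ^ 2 / (2 * ρ x ^ 2)) with hθdef
  -- continuity of the ingredients
  have hρc : Continuous ρ := continuous_mollDensity r w
  have hMc : Continuous M := continuous_mollMomentum r w
  have hEc : Continuous E := continuous_mollEnergy r w
  have hEtc : Continuous fun x => totalEnergyDensity (ρt x) (ut x) (θt x) := continuous_totalEnergy_ref hρtc hθtc hutc
  have hHtc : Continuous fun x => Hs σ (ρt x) (θt x) := continuous_Hs_ref σ hf hρtc hθtc hρt hθt hσ hρtb
  -- the pointwise inequality with the uniform constant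
  have hpt : ∀ x, ψ x * totalEnergyDensity (ρt x) (ut x) (θt x) +
      ψ x * θt x * (Hs σ (ρt x) (θt x) - Hs σ (ρ x) (θ x)) - K₀ * |ρ x - ρt x| +
      ψ x * ⟪ut x, M x - ρt x • ut x⟫_ℝ ≤ ψ x * E x := by
    intro x
    have hcs : ‖M x‖ ^ 2 ≤ 2 * E x * ρ x := normSq_mollMomentum_le hr w x
    have hzero : ρ x = 0 → M x = 0 ∧ E x = 0 := fun h => moll_eq_zero_of_density_eq_zero hr hn w x h
    have h := pointwise_energy_floor σ hσ (ut := ut x) (hψ x) (hθt x) (hρt x) (mollDensity_nonneg hr w x) hcs hzero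
      (hJ x) hB hL (hρb x) (hρtb x)
    simp only at h
    have hHρ : Hs σ (ρ x) (θ x) = (if 0 < ρ x ∧ 0 < 2 / 3 * (E x / ρ x - ‖M x‖ ^ 2 / (2 * ρ x ^ 2)) then
        -(ρ x * (3 / 2 * Real.log (2 / 3 * (E x / ρ x - ‖M x‖ ^ 2 / (2 * ρ x ^ 2))) - Real.log (ρ x) -
          hsExcessFreeEnergy (ρ x * σ ^ 3))) else 0) := rfl
    have hHt : Hs σ (ρt x) (θt x) = (if 0 < ρt x ∧ 0 < θt x then
        -(ρt x * (3 / 2 * Real.log (θt x) - Real.log (ρt x) - hsExcessFreeEnergy (ρt x * σ ^ 3))) else 0) := rfl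
    have hKx := hK x
    have habs : 0 ≤ |ρ x - ρt x| := abs_nonneg _
    have hweak : K₀ * |ρ x - ρt x| ≥
        ψ x * (θt x * (3 / 2 * |Real.log (θt x)| + |Real.log (ρt x)| + 1 + B + ρt x * σ ^ 3 * L) +
          3 / 2 * θt x + ‖ut x‖ ^ 2 / 2) * |ρ x - ρt x| := mul_le_mul_of_nonneg_right hKx habs
    rw [hHρ, hHt]
    linarith [h, hweak]
  -- integrability of every term
  have i1 : Integrable (fun x => ψ x * totalEnergyDensity (ρt x) (ut x) (θt x)) := integrable_of_continuous_T3 (hψc.mul hEtc)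
  have i2a : Integrable (fun x => ψ x * θt x * Hs σ (ρt x) (θt x)) := integrable_of_continuous_T3 ((hψc.mul hθtc).mul hHtc)
  have i2b : Integrable (fun x => ψ x * θt x * Hs σ (ρ x) (θ x)) := by
    obtain ⟨C, -, hC⟩ := exists_forall_abs_le_of_continuous (hψc.mul hθtc)
    refine hint.bdd_mul (c := C) (hψc.mul hθtc).aestronglyMeasurable (ae_of_all _ fun x => ?_)
    rw [Real.norm_eq_abs]
    exact hC x
  have i2 : Integrable (fun x => ψ x * θt x * (Hs σ (ρt x) (θt x) - Hs σ (ρ x) (θ x))) := by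
    have : (fun x => ψ x * θt x * (Hs σ (ρt x) (θt x) - Hs σ (ρ x) (θ x))) =
        fun x => ψ x * θt x * Hs σ (ρt x) (θt x) - ψ x * θt x * Hs σ (ρ x) (θ x) := funext fun x => by ring
    rw [this]
    exact i2a.sub i2b
  have i3 : Integrable (fun x => K₀ * |ρ x - ρt x|) := integrable_of_continuous_T3 (continuous_const.mul (hρc.sub hρtc).abs)
  have i4 : Integrable (fun x => ψ x * ⟪ut x, M x - ρt x • ut x⟫_ℝ) :=
    integrable_of_continuous_T3 (hψc.mul (hutc.inner (hMc.sub (hρtc.smul hutc))))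
  have i5 : Integrable (fun x => ψ x * E x) := integrable_of_continuous_T3 (hψc.mul hEc)
  -- integrate
  have i12 : Integrable (fun x => ψ x * totalEnergyDensity (ρt x) (ut x) (θt x) +
      ψ x * θt x * (Hs σ (ρt x) (θt x) - Hs σ (ρ x) (θ x))) := i1.add i2
  have i123 : Integrable (fun x => ψ x * totalEnergyDensity (ρt x) (ut x) (θt x) +
      ψ x * θt x * (Hs σ (ρt x) (θt x) - Hs σ (ρ x) (θ x)) - K₀ * |ρ x - ρt x|) := i12.sub i3
  have i1234 : Integrable (fun x => ψ x * totalEnergyDensity (ρt x) (ut x) (θt x) +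
      ψ x * θt x * (Hs σ (ρt x) (θt x) - Hs σ (ρ x) (θ x)) - K₀ * |ρ x - ρt x| +
      ψ x * ⟪ut x, M x - ρt x • ut x⟫_ℝ) := i123.add i4
  have hmono := integral_mono i1234 i5 hpt
  rw [integral_add i123 i4, integral_sub i12 i3, integral_add i1 i2, integral_const_mul] at hmono
  exact hmono

/-! ## §3 The momentum term in components -/

/-- A coordinate of a Bochner integral of an `ℝ³`-valued function is the integral of the coordinate. [folklore] -/
theorem integral_apply_V3 {f : T3 → V3} (hf : Integrable f) (k : Fin 3) : (∫ x, f x) k = ∫ x, f x k := by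
  have h := (EuclideanSpace.proj (𝕜 := ℝ) (ι := Fin 3) k).integral_comp_comm hf
  simpa using h.symm

/-- **Component form of the momentum term**: for continuous `χ`, `ũ` and an `ℝ³`-valued continuous field `X`,
`∫ χ⟪ũ, X⟫ = Σ_k ∫ (χ·ũ_k)·X_k`. [folklore] -/
theorem integral_inner_eq_sum {χ : T3 → ℝ} {ut X : T3 → V3} (hχ : Continuous χ) (hut : Continuous ut)
    (hX : Continuous X) :
    ∫ x, χ x * ⟪ut x, X x⟫_ℝ = ∑ k : Fin 3, ∫ x, χ x * ut x k * X x k := by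
  have hpt : ∀ x, χ x * ⟪ut x, X x⟫_ℝ = ∑ k : Fin 3, χ x * ut x k * X x k := by
    intro x
    rw [PiLp.inner_apply, Finset.mul_sum]
    refine Finset.sum_congr rfl fun k _ => ?_
    simp only [RCLike.inner_apply, conj_trivial]
    ring
  simp_rw [hpt]
  rw [integral_finsetSum _ fun k _ => ?_]
  exact integrable_of_continuous_T3 ((hχ.mul ((EuclideanSpace.proj (𝕜 := ℝ) k).continuous.comp hut)).mul
    ((EuclideanSpace.proj (𝕜 := ℝ) k).continuous.comp hX))

/-! ## §4 Small inputs of the probabilistic assembly (part 3) -/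

/-- **Band data of the hard-sphere equation of state** from the PROVED `HsEosLowDensity` (`f_ex` agrees on `[0, η_E)`
with a function analytic on `(−η_E, η_E)`): on the half band `[0, η_E/2]`, `f_ex` is continuous, bounded by some `B`,
and `L`-Lipschitz. [folklore] -/
theorem eos_band : ∃ ηE : ℝ, 0 < ηE ∧ ContinuousOn hsExcessFreeEnergy (Set.Icc 0 (ηE / 2)) ∧
    ∃ B : ℝ, 0 ≤ B ∧ (∀ a ∈ Set.Icc (0 : ℝ) (ηE / 2), |hsExcessFreeEnergy a| ≤ B) ∧
    ∃ L : ℝ, 0 ≤ L ∧ ∀ a ∈ Set.Icc (0 : ℝ) (ηE / 2), ∀ b ∈ Set.Icc (0 : ℝ) (ηE / 2),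
      |hsExcessFreeEnergy a - hsExcessFreeEnergy b| ≤ L * |a - b| := by
  obtain ⟨ηE, hηE, F, hFan, hFeq, -, -, -⟩ :=
    Summit.AtomisticToContinuum.HydrodynamicLimit.Theses.InformationPercolationEngine.HsEosLowDensity_holds
  have hsub : Set.Icc (0 : ℝ) (ηE / 2) ⊆ Set.Ioo (-ηE) ηE := Set.Icc_subset_Ioo (by linarith) (by linarith)
  have hsub' : Set.Icc (0 : ℝ) (ηE / 2) ⊆ Set.Ico 0 ηE := fun a ha => ⟨ha.1, by linarith [ha.2]⟩
  have hFc : ContinuousOn F (Set.Icc 0 (ηE / 2)) := hFan.continuousOn.mono hsub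
  have hfc : ContinuousOn hsExcessFreeEnergy (Set.Icc 0 (ηE / 2)) := hFc.congr fun a ha => hFeq (hsub' ha)
  obtain ⟨B, hB⟩ := (isCompact_Icc : IsCompact (Set.Icc (0 : ℝ) (ηE / 2))).exists_bound_of_continuousOn hFc
  have hdc : ContinuousOn (deriv F) (Set.Icc 0 (ηE / 2)) := hFan.deriv.continuousOn.mono hsub
  obtain ⟨L, hL⟩ := (isCompact_Icc : IsCompact (Set.Icc (0 : ℝ) (ηE / 2))).exists_bound_of_continuousOn hdc
  refine ⟨ηE, hηE, hfc, max B 0, le_max_right _ _, fun a ha => ?_, max L 0, le_max_right _ _, fun a ha b hb => ?_⟩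
  · rw [hFeq (hsub' ha), ← Real.norm_eq_abs]
    exact (hB a ha).trans (le_max_left _ _)
  · rw [hFeq (hsub' ha), hFeq (hsub' hb)]
    have hdiff : ∀ x ∈ Set.Icc (0 : ℝ) (ηE / 2), DifferentiableAt ℝ F x := fun x hx =>
      (hFan x (hsub hx)).differentiableAt
    have hbound : ∀ x ∈ Set.Icc (0 : ℝ) (ηE / 2), ‖deriv F x‖ ≤ max L 0 := fun x hx => (hL x hx).trans (le_max_left _ _)
    have h := (convex_Icc (0 : ℝ) (ηE / 2)).norm_image_sub_le_of_norm_deriv_le hdiff hbound hb ha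
    rw [Real.norm_eq_abs, Real.norm_eq_abs] at h
    exact h

/-- Modulus of continuity in the minimal-image distance for an `ℝ³`-valued continuous function on `𝕋³`. [folklore] -/
theorem exists_modulus_euclidDist_V3 {g : T3 → V3} (hg : Continuous g) {κ : ℝ} (hκ : 0 < κ) :
    ∃ r : ℝ, 0 < r ∧ ∀ x y, Torus.euclidDist x y < r → ‖g x - g y‖ ≤ κ := by
  have huc : UniformContinuous g := CompactSpace.uniformContinuous_of_continuous hg
  obtain ⟨r, hr, h⟩ := Metric.uniformContinuous_iff.1 huc κ hκ
  refine ⟨r, hr, fun x y hxy => ?_⟩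
  have hd : dist x y < r :=
    calc dist x y = ‖x - y‖ := dist_eq_norm x y
      _ ≤ Torus.euclidDist x y := Torus.norm_sub_le_euclidDist_holds x y
      _ < r := hxy
  have := h hd
  rw [dist_eq_norm] at this
  exact this.le

/-- **The cold-cell threshold**: if `0 < θmin ≤ θ̃`, `|f_ex(ρσ³)| ≤ B` and `0 < ρ ≤ exp(3/2 log θmin − 3/2 − B)`, then
`(3/2)ρ ≤ g̃(ρ) = ρ(3/2 log θ̃ − log ρ − f_ex(ρσ³))`. [folklore] -/
theorem cold_threshold {σ θmin θt B ρ : ℝ} (hθmin : 0 < θmin) (hθ : θmin ≤ θt)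
    (hB : |hsExcessFreeEnergy (ρ * σ ^ 3)| ≤ B) (hρ : 0 < ρ)
    (hρle : ρ ≤ Real.exp (3 / 2 * Real.log θmin - 3 / 2 - B)) :
    3 / 2 * ρ ≤ ρ * (3 / 2 * Real.log θt - Real.log ρ - hsExcessFreeEnergy (ρ * σ ^ 3)) := by
  have hlogρ : Real.log ρ ≤ 3 / 2 * Real.log θmin - 3 / 2 - B := by
    have := Real.log_le_log hρ hρle
    rwa [Real.log_exp] at this
  have hlogθ : Real.log θmin ≤ Real.log θt := Real.log_le_log hθmin hθ
  have hf : hsExcessFreeEnergy (ρ * σ ^ 3) ≤ B := (le_abs_self _).trans hB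
  have key : 3 / 2 ≤ 3 / 2 * Real.log θt - Real.log ρ - hsExcessFreeEnergy (ρ * σ ^ 3) := by linarith
  nlinarith

/-- A nonpositive cell temperature at positive density means `2Eρ ≤ |M|²`. [folklore] -/
theorem two_mul_mul_sub_le_zero_of_theta_nonpos {ρ E : ℝ} {M : V3} (hρ : 0 < ρ)
    (hθ : 2 / 3 * (E / ρ - ‖M‖ ^ 2 / (2 * ρ ^ 2)) ≤ 0) : 2 * E * ρ - ‖M‖ ^ 2 ≤ 0 := by
  have h1 : E / ρ - ‖M‖ ^ 2 / (2 * ρ ^ 2) ≤ 0 := by linarith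
  have h2 : E / ρ ≤ ‖M‖ ^ 2 / (2 * ρ ^ 2) := by linarith
  rw [div_le_div_iff₀ hρ (by positivity)] at h2
  nlinarith

/-! ## §5 Plumbing for part 3 -/

/-- A positive real below a positive extended real. [folklore] -/
theorem exists_pos_ofReal_le {e : ℝ≥0∞} (he : 0 < e) : ∃ δ' : ℝ, 0 < δ' ∧ ENNReal.ofReal δ' ≤ e := by
  rcases eq_or_ne e ⊤ with h | h
  · exact ⟨1, one_pos, h ▸ le_top⟩
  · exact ⟨e.toReal, ENNReal.toReal_pos he.ne' h, (ENNReal.ofReal_toReal h).le⟩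


/-- **The `k`-th momentum component against the `χ`-tested momentum field.** For a test `χ_k = χ·ũ_k` with an
`r`-modulus `κ`, a mean-speed bound `n⁻¹Σ|vᵢ| ≤ C_s` and a deviation bound
`‖M_N[χ_k] − ∫(χ_kρ̃)ũ‖ ≤ D` of the tested empirical momentum:
`|∫ χ ũ_k (m_r − ρ̃ũ)_k| ≤ κ C_s + D` (cone commutator `norm_empiricalMomentumField_sub_integral_smul_le`, then the
coordinate is bounded by the norm). [folklore] -/
theorem abs_momentum_term_le {n : ℕ} (w : Config n (Fin 3) T3) {r κ Cs D : ℝ} (hr : 0 < r) (hr2 : r ≤ 1 / 2)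
    {χ ρt : T3 → ℝ} {ut : T3 → V3} (hχ : Continuous χ) (hρt : Continuous ρt) (hut : Continuous ut) (k : Fin 3)
    (hmod : ∀ x y, Torus.euclidDist x y < r → |χ x * ut x k - χ y * ut y k| ≤ κ)
    (hspeed : (n : ℝ)⁻¹ * ∑ i, ‖(w i).2‖ ≤ Cs) (hκ : 0 ≤ κ)
    (hdev : ‖empiricalMomentumField w (fun x => χ x * ut x k) - ∫ x, ((χ x * ut x k) * ρt x) • ut x‖ ≤ D) :
    |∫ x, χ x * ut x k * (empiricalMomentumField w (fun y => cone r y x) - ρt x • ut x) k| ≤ κ * Cs + D := by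
  set χk : T3 → ℝ := fun x => χ x * ut x k with hχkdef
  have hχk : Continuous χk := hχ.mul ((EuclideanSpace.proj (𝕜 := ℝ) k).continuous.comp hut)
  have hMc : Continuous fun x => empiricalMomentumField w (fun y => cone r y x) := continuous_mollMomentum r w
  have iA : Integrable (fun x => χk x • empiricalMomentumField w (fun y => cone r y x)) :=
    integrable_of_continuous_T3 (hχk.smul hMc)
  have iB : Integrable (fun x => (χk x * ρt x) • ut x) := integrable_of_continuous_T3 ((hχk.mul hρt).smul hut)
  -- the integrand is the `k`-th coordinate of `χ_k • m_r − (χ_k ρ̃) • ũ`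
  have hpt : ∀ x, χ x * ut x k * (empiricalMomentumField w (fun y => cone r y x) - ρt x • ut x) k =
      (χk x • empiricalMomentumField w (fun y => cone r y x) - (χk x * ρt x) • ut x) k := by
    intro x
    simp only [hχkdef, PiLp.sub_apply, PiLp.smul_apply, smul_eq_mul]
    ring
  simp_rw [hpt]
  have iAB : Integrable (fun x => χk x • empiricalMomentumField w (fun y => cone r y x) - (χk x * ρt x) • ut x) :=
    iA.sub iB
  rw [← integral_apply_V3 iAB k, integral_sub iA iB]
  have hcoord : |((∫ x, χk x • empiricalMomentumField w (fun y => cone r y x)) - ∫ x, (χk x * ρt x) • ut x) k| ≤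
      ‖(∫ x, χk x • empiricalMomentumField w (fun y => cone r y x)) - ∫ x, (χk x * ρt x) • ut x‖ := by
    rw [← Real.norm_eq_abs]
    exact PiLp.norm_apply_le _ k
  refine hcoord.trans ?_
  have hcomm : ‖empiricalMomentumField w χk - ∫ x, χk x • empiricalMomentumField w (fun y => cone r y x)‖ ≤ κ * Cs :=
    (norm_empiricalMomentumField_sub_integral_smul_le hr hr2 hχk hmod w).trans (mul_le_mul_of_nonneg_left hspeed hκ)
  calc ‖(∫ x, χk x • empiricalMomentumField w (fun y => cone r y x)) - ∫ x, (χk x * ρt x) • ut x‖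
      ≤ ‖(∫ x, χk x • empiricalMomentumField w (fun y => cone r y x)) - empiricalMomentumField w χk‖ +
        ‖empiricalMomentumField w χk - ∫ x, (χk x * ρt x) • ut x‖ := norm_sub_le_norm_sub_add_norm_sub _ _ _
    _ ≤ κ * Cs + D := add_le_add (by rwa [norm_sub_rev]) hdev

/-- **Registered sub-goal** (helper 2/4 of `stub_energyFloorOfEntropyFloor`): the cold-cell threshold. [folklore] -/
theorem stub_energyFloorColdThreshold : ∀ {σ θmin θt B ρ : ℝ}, 0 < θmin → θmin ≤ θt → |Literature.MathematicalPhysics.KineticTheory.hsExcessFreeEnergy (ρ * σ ^ 3)| ≤ B → 0 < ρ → ρ ≤ Real.exp (3 / 2 * Real.log θmin - 3 / 2 - B) → 3 / 2 * ρ ≤ ρ * (3 / 2 * Real.log θt - Real.log ρ - Literature.MathematicalPhysics.KineticTheory.hsExcessFreeEnergy (ρ * σ ^ 3)) :=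
  fun h1 h2 h3 h4 h5 => cold_threshold h1 h2 h3 h4 h5

end Summit.AtomisticToContinuum.HydrodynamicLimit.Theorems.ParityBandClosureEnergyFloor

end
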